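import Summits.BirchSwinnertonDyer.BirchSwinnertonDyer.Theorems.PrintCf2SplitBadTwoLayerFieldH1Transport
import Summits.BirchSwinnertonDyer.BirchSwinnertonDyer.Theorems.PrintCf2SplitBadTwoLayerFieldPlaces
import Literature.NumberTheory.EllipticCurves.IwasawaSelmerProofs
import Literature.NumberTheory.EllipticCurves.GreenbergVatsal2000.GreenbergSelmerGroups
import HarnessLib

/-!
# Crux `PrintCf2.SplitBadTwoRankOneOfFacts` (stmt-BirchSwinnertonDyer-20368), S3n′-FACT-FREE road (a), H¹-transport FILE 3:
# CHANGE OF COEFFICIENTS, THE `unramifiedKer` READING, AND THE PACKAGED TRANSPORT ON THE DOUBLE COSETS `D_w \ Γ_K / U`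

Cell `bsd-print-cf2`, WIDTH seat `bsd-line-cf2-p1-w6` g6 (prover-bsd-line-cf2-p1-w6-g6-0); `--supports stmt-BirchSwinnertonDyer-20368` (helper,
Theses-free). HONEST FRAMING: cohomological bookkeeping; nothing here closes the crux or a registered stub; BSD is not proved by any of this;
no summit statement is proved by this seat. No definition, no named fact, no instance, no `sorry`.

Sequel of `…LayerFieldH1Transport` (FILE 2: `Θ`, `Ψ`, (β1)(β2)) and `…LayerFieldPlaces` (FILE 1: `f : D_w \ Γ_K / U ≃ {w' ∣ w}`), answering -w7 g6's shape
requests (R1)–(R3) (STATUS 06:32:06Z) for the (LSₙ) assembler: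

* §1 `exists_contIntertwiningMap_restrictField` — a `Γ_K`-equivariant `j : M₀ →+ M` gives `jL : ρ₀L →ⁱL ρL` with `jL m = j m`;
  **`localMap_transport_comm`** (β3): `localMap jL (inr w') ∘ Ψ₀ = Ψ ∘ resH1Hom id j` for two local transports built on the same `θΨ`-values.
* §2 `mem_unramifiedKer_iff_resOfLe_resH1Hom_eq_zero` (`unramifiedKer U M w` unfolded to `resOfLe (inertiaIn ≤ decompIn) ∘ res_{U⊓D_w}`), and
  `conjH1_mul_of_mem_eq` (`conjH1 U M (σ·u) = conjH1 U M σ` for `u ∈ U`: inner automorphisms act trivially).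
* §3 **`exists_transport_of_conj`** — the (β1)(β2)(β2')(β3)(α′) package for ANY `σ` whose local groups match `w'` UP TO `Γ_L`-CONJUGATION
  (`hD : U ⊓ σ⁻¹·D_w·σ = res(τ·D_{w'}·τ⁻¹)`, `hI` likewise — FILE 1 (P2) VERBATIM): reduce to `σ₁ := σ·res τ` (exact) and `conjH1 (σ·res τ) = conjH1 σ`.
* §4 **`exists_transport`** — ON THE DOUBLE COSETS: for `L/K` normal finite, `U` with `galFixing K L = U` (e.g. `U := κ₂.layerSubgroup n`, `L := κ₂.layer n`,
  the tree's `galFixing_layer`), `∃ Θ jL f` such that for every finite `w` and every `q : DoubleCoset.Quotient ↑(decomp w) ↑U`, with `w' := f q`,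
  `∃ Ψ₀ Ψ` with (β1) for `conjH1 U M q.out z` VERBATIM, (α′) `conjH1 U M q.out z ∈ unramifiedKer U M w ↔ loc_{w'} (Θ z) ∈ H¹_ur`, (β2), (β2'), (β3).

References: J.-P. Serre, *Galois Cohomology* (1997) I §2.4–§2.5, §5.1; *Local Fields* (1979) VII §5 Prop. 3; J. Neukirch, A. Schmidt, K. Wingberg
(2008) (1.5.2), (1.6.3). beyond-print theorem: no (folklore).
-/

set_option linter.dupNamespace false

noncomputable section

open scoped NumberField Pointwise
open CategoryTheory IsDedekindDomain Field NumberField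
open Literature.NumberTheory.GaloisRepresentations Literature.NumberTheory.GaloisRepresentations.LocalWeilDatum
open Literature.NumberTheory.EllipticCurves Literature.NumberTheory.EllipticCurves.GreenbergSelmer
open Literature.NumberTheory.EllipticCurves.GreenbergVatsal2000
open Literature.NumberTheory.GaloisRepresentations.DiscreteGaloisModule (localMap)
open scoped ContRepresentation
open Summit.BirchSwinnertonDyer.Rank1Residual.X11b
open Summit.BirchSwinnertonDyer.BirchSwinnertonDyer.Theorems.PrintCf2.LocalGroupsBridge
open Summit.BirchSwinnertonDyer.BirchSwinnertonDyer.Theorems.PrintCf2.LayerFieldPlaces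

namespace Summit.BirchSwinnertonDyer.BirchSwinnertonDyer.Theorems.PrintCf2.LayerFieldH1

/-! ## §1. Change of coefficients -/

section Coeff

variable {K : Type} [Field K] [NumberField K] (L : IntermediateField K (AlgebraicClosure K)) [NumberField L]
  (U : Subgroup (absoluteGaloisGroup K)) [U.Normal]
  (M₀ : Type) [AddCommGroup M₀] [DistribMulAction (absoluteGaloisGroup K) M₀] [TopologicalSpace M₀] [DiscreteTopology M₀]
  (hM₀ : ∀ m : M₀, IsOpen {σ : absoluteGaloisGroup K | σ • m = m})
  (M : Type) [AddCommGroup M] [DistribMulAction (absoluteGaloisGroup K) M] [TopologicalSpace M] [DiscreteTopology M]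
  (hM : ∀ m : M, IsOpen {σ : absoluteGaloisGroup K | σ • m = m})
  (j : M₀ →+ M) (hj : ∀ (σ : absoluteGaloisGroup K) (m : M₀), j (σ • m) = σ • j m)

omit [NumberField K] [NumberField L] [U.Normal] in
include hj in
/-- A `Γ_K`-equivariant `j : M₀ → M` is a continuous intertwining map of the restricted modules over `L` (same underlying map).
[cite: SerreGaloisCohomology1997, I §2.4] -/
theorem exists_contIntertwiningMap_restrictField :
    ∃ jL : ((LocBridge.ofSMul M₀ hM₀).restrictField L).toContRepresentation →ⁱL ((LocBridge.ofSMul M hM).restrictField L).toContRepresentation,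
      ∀ m, jL m = j m := by
  let jK : (LocBridge.ofSMul M₀ hM₀).toContRepresentation →ⁱL (LocBridge.ofSMul M hM).toContRepresentation :=
    { toContinuousLinearMap := ⟨j.toIntLinearMap, continuous_of_discreteTopology⟩
      isIntertwining' := fun g ↦ by ext m; exact hj g m }
  exact ⟨jK.restrictField L, fun _ ↦ rfl⟩

omit [U.Normal] in
/-- **(β3) CHANGE OF COEFFICIENTS COMMUTES WITH THE LOCAL TRANSPORT.** For two local transports `Ψ₀` (coefficients `M₀`) and `Ψ` (`M`) at the
same `(w, σ, w')`, characterised on cocycles through homomorphisms `θΨ₀`, `θΨ : Γ_{L_{w'}} → U ⊓ D_w` with the same values, and the restricted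
intertwining map `jL` of `j`: `localMap jL (inr w') (Ψ₀ c) = Ψ (H¹(id, j) c)`. [cite: SerreGaloisCohomology1997, I §2.4] -/
theorem localMap_transport_comm (w : HeightOneSpectrum (𝓞 K)) (σ : absoluteGaloisGroup K) (w' : HeightOneSpectrum (𝓞 L))
    (jL : ((LocBridge.ofSMul M₀ hM₀).restrictField L).toContRepresentation →ⁱL ((LocBridge.ofSMul M hM).restrictField L).toContRepresentation)
    (hjL : ∀ m, jL m = j m)
    (θΨ₀ θΨ : absoluteGaloisGroup (w'.adicCompletion L) →ₜ* decompIn U w)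
    (hθ : ∀ g, ((θΨ₀ g : decomp w) : absoluteGaloisGroup K) = ((θΨ g : decomp w) : absoluteGaloisGroup K))
    (Ψ₀ : subgroupH1 (decompIn U w) M₀ →+ galoisCohomology (GaloisRep.toLocal w' ((LocBridge.ofSMul M₀ hM₀).restrictField L)) 1)
    (hΨ₀ : ∀ χ : contOneCocycles (discreteTopRep (decompIn U w) M₀),
      ∃ χ' : contOneCocycles (GaloisRep.toLocal w' ((LocBridge.ofSMul M₀ hM₀).restrictField L)).toTopRep,
        Ψ₀ (oneCocycleClass _ χ) = oneCocycleClass _ χ' ∧ ∀ g, χ'.1 g = σ⁻¹ • χ.1 (θΨ₀ g))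
    (Ψ : subgroupH1 (decompIn U w) M →+ galoisCohomology (GaloisRep.toLocal w' ((LocBridge.ofSMul M hM).restrictField L)) 1)
    (hΨ : ∀ χ : contOneCocycles (discreteTopRep (decompIn U w) M),
      ∃ χ' : contOneCocycles (GaloisRep.toLocal w' ((LocBridge.ofSMul M hM).restrictField L)).toTopRep,
        Ψ (oneCocycleClass _ χ) = oneCocycleClass _ χ' ∧ ∀ g, χ'.1 g = σ⁻¹ • χ.1 (θΨ g))
    (c : subgroupH1 (decompIn U w) M₀) :
    localMap jL (Sum.inr w') (Ψ₀ c) =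
      Ψ (resH1Hom (ContinuousMonoidHom.id (decompIn U w)) j (fun g m ↦ hj ((g : decomp w) : absoluteGaloisGroup K) m) c) := by
  obtain ⟨χ, rfl⟩ := oneCocycleClass_surjective _ c
  obtain ⟨χ₀', h₀, h₀'⟩ := hΨ₀ χ
  obtain ⟨χ₁', h₁, h₁'⟩ := hΨ (contOneCocycles.pullback (ContinuousMonoidHom.id (decompIn U w))
    (resHomOfEquivariant _ j fun g m ↦ hj ((g : decomp w) : absoluteGaloisGroup K) m) χ)
  rw [h₀, resH1Hom_oneCocycleClass, h₁]
  change galoisCohomology.map (jL.restrictField _) 1 _ = _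
  erw [galoisCohomology.map_one_oneCocycleClass]
  congr 1
  apply Subtype.ext
  ext g
  change jL (χ₀'.1 g) = χ₁'.1 g
  rw [h₀', h₁', hjL, hj, contOneCocycles.pullback_apply]
  change σ⁻¹ • j (χ.1 (θΨ₀ g)) = σ⁻¹ • j (χ.1 (θΨ g))
  have hg : θΨ₀ g = θΨ g := Subtype.ext (Subtype.ext (hθ g))
  rw [hg]

end Coeff

/-! ## §2. The `unramifiedKer` reading and inner automorphisms -/

section Reading

variable {K : Type} [Field K] [NumberField K] (U : Subgroup (absoluteGaloisGroup K)) [U.Normal]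
  (M : Type) [AddCommGroup M] [DistribMulAction (absoluteGaloisGroup K) M] [TopologicalSpace M] [DiscreteTopology M]

omit [U.Normal] in
/-- `c ∈ unramifiedKer U M w ↔ resOfLe (inertiaIn ≤ decompIn) (res_{U ⊓ D_w} c) = 0` (`inertiaInToH = decompInToH ∘ incl`, `resH1Hom_comp`).
[cite: GreenbergVatsal2000, §2 p. 17] -/
theorem mem_unramifiedKer_iff_resOfLe_resH1Hom_eq_zero (w : HeightOneSpectrum (𝓞 K)) (c : subgroupH1 U M) :
    c ∈ GreenbergVatsal2000.unramifiedKer U M w ↔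
      resOfLe M (inertiaIn_le_decompIn U w) (resH1Hom (decompInToH U w) (AddMonoidHom.id M) (fun _ _ ↦ rfl) c) = 0 := by
  rw [GreenbergVatsal2000.unramifiedKer, AddMonoidHom.mem_ker, resOfLe, ← AddMonoidHom.comp_apply, resH1Hom_comp]
  rfl

omit [NumberField K] in
/-- **`conjH1 U M (σ·u) = conjH1 U M σ` for `u ∈ U`**: inner automorphisms act trivially on `H¹(U, M)` (`conjH1_mul`, `conjH1_of_mem`).
[cite: SerreLocalFields1979, VII.§5 Prop. 3] -/
theorem conjH1_mul_of_mem_eq {σ u : absoluteGaloisGroup K} (hu : u ∈ U) (z : subgroupH1 U M) :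
    conjH1 U M (σ * u) z = conjH1 U M σ z := by
  rw [conjH1_mul_holds U M σ u, AddMonoidHom.comp_apply, conjH1_of_mem_holds U M hu, AddMonoidHom.id_apply]

end Reading

/-! ## §3. The package for a `σ` matching `w'` up to `Γ_L`-conjugation -/

section Package

variable {K : Type} [Field K] [NumberField K] (L : IntermediateField K (AlgebraicClosure K)) [NumberField L]
  (U : Subgroup (absoluteGaloisGroup K)) [U.Normal] (hU : (absGaloisRestrict K L).toMonoidHom.range = U)
  (M₀ : Type) [AddCommGroup M₀] [DistribMulAction (absoluteGaloisGroup K) M₀] [TopologicalSpace M₀] [DiscreteTopology M₀]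
  (hM₀ : ∀ m : M₀, IsOpen {σ : absoluteGaloisGroup K | σ • m = m})
  (M : Type) [AddCommGroup M] [DistribMulAction (absoluteGaloisGroup K) M] [TopologicalSpace M] [DiscreteTopology M]
  (hM : ∀ m : M, IsOpen {σ : absoluteGaloisGroup K | σ • m = m})
  (j : M₀ →+ M) (hj : ∀ (σ : absoluteGaloisGroup K) (m : M₀), j (σ • m) = σ • j m)


omit [NumberField K] [NumberField L] in
/-- From the `Γ_L`-conjugate matching `U ⊓ σ⁻¹·D·σ = res(τ·H·τ⁻¹)` to the EXACT matching for `σ₁ = σ · res τ`: `U ⊓ σ₁⁻¹·D·σ₁ = res(H)`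
(`U` normal, `res` injective). [cite: NeukirchANT1999, Ch. I §9 (9.4)] -/
theorem inf_conj_mul_eq_map_of_conj {σ : absoluteGaloisGroup K} {τ : absoluteGaloisGroup L} {D : Subgroup (absoluteGaloisGroup K)}
    {H : Subgroup (absoluteGaloisGroup L)}
    (h : U ⊓ MulAut.conj σ⁻¹ • D = (MulAut.conj τ • H).map (absGaloisRestrict K L).toMonoidHom) :
    U ⊓ MulAut.conj (σ * absGaloisRestrict K L τ)⁻¹ • D = H.map (absGaloisRestrict K L).toMonoidHom := by
  have hmapconj : (MulAut.conj τ • H).map (absGaloisRestrict K L).toMonoidHom =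
      MulAut.conj (absGaloisRestrict K L τ) • H.map (absGaloisRestrict K L).toMonoidHom := by
    rw [Subgroup.pointwise_smul_def, Subgroup.pointwise_smul_def, Subgroup.map_map, Subgroup.map_map]
    congr 1
    ext x
    change absGaloisRestrict K L (τ * x * τ⁻¹) = absGaloisRestrict K L τ * absGaloisRestrict K L x * (absGaloisRestrict K L τ)⁻¹
    rw [map_mul, map_mul, map_inv]
  rw [hmapconj] at h
  have h2 := congrArg (fun S : Subgroup (absoluteGaloisGroup K) ↦ MulAut.conj (absGaloisRestrict K L τ)⁻¹ • S) h
  rw [smul_smul, ← map_mul, inv_mul_cancel, map_one, one_smul, Subgroup.smul_inf, Subgroup.Normal.conj_smul_eq_self,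
    smul_smul, ← map_mul, ← mul_inv_rev] at h2
  exact h2

/-- **THE TRANSPORT PACKAGE AT A PLACE `w'` CUT OUT BY `σ` UP TO `Γ_L`-CONJUGATION** (FILE 1 (P2) hypotheses VERBATIM): for the `Θ` of FILE 2 §1
(coefficients `M`) and the restricted intertwining map `jL` of `j`, there are `Ψ₀`, `Ψ` with (β1) for `conjH1 U M σ z` itself, (α′) the
`unramifiedKer` reading, (β2) for both modules, (β2') injectivity and (β3) the change of coefficients.
[cite: SerreGaloisCohomology1997, I §2.4–§2.5, §5.1] [cite: GreenbergLNM1716, §2] -/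
theorem exists_transport_of_conj (w : HeightOneSpectrum (𝓞 K)) (σ : absoluteGaloisGroup K) (w' : HeightOneSpectrum (𝓞 L))
    (τ : absoluteGaloisGroup L)
    (hD : U ⊓ MulAut.conj σ⁻¹ • decomp w = (MulAut.conj τ • decomp (K := L) w').map (absGaloisRestrict K L).toMonoidHom)
    (hI : U ⊓ MulAut.conj σ⁻¹ • inertia w = (MulAut.conj τ • inertia (K := L) w').map (absGaloisRestrict K L).toMonoidHom)
    (Θ : subgroupH1 U M ≃+ galoisCohomology ((LocBridge.ofSMul M hM).restrictField L) 1)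
    (hΘ : ∀ φ : contOneCocycles (discreteTopRep U M), ∃ ψ : contOneCocycles ((LocBridge.ofSMul M hM).restrictField L).toTopRep,
      Θ (oneCocycleClass _ φ) = oneCocycleClass _ ψ ∧ ∀ γ, ψ.1 γ = φ.1 ⟨absGaloisRestrict K L γ, absGaloisRestrict_mem L U hU γ⟩)
    (jL : ((LocBridge.ofSMul M₀ hM₀).restrictField L).toContRepresentation →ⁱL ((LocBridge.ofSMul M hM).restrictField L).toContRepresentation)
    (hjL : ∀ m, jL m = j m) :
    ∃ (Ψ₀ : subgroupH1 (decompIn U w) M₀ →+ galoisCohomology (GaloisRep.toLocal w' ((LocBridge.ofSMul M₀ hM₀).restrictField L)) 1)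
      (Ψ : subgroupH1 (decompIn U w) M →+ galoisCohomology (GaloisRep.toLocal w' ((LocBridge.ofSMul M hM).restrictField L)) 1),
      (∀ z : subgroupH1 U M,
        Ψ (resH1Hom (decompInToH U w) (AddMonoidHom.id M) (fun _ _ ↦ rfl) (conjH1 U M σ z)) =
          galoisCohomology.localization ((LocBridge.ofSMul M hM).restrictField L) (Sum.inr w') 1 (Θ z)) ∧
      (∀ z : subgroupH1 U M,
        conjH1 U M σ z ∈ GreenbergVatsal2000.unramifiedKer U M w ↔
          galoisCohomology.localization ((LocBridge.ofSMul M hM).restrictField L) (Sum.inr w') 1 (Θ z) ∈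
            DiscreteGaloisModule.unramifiedSubgroup (GaloisRep.toLocal w' ((LocBridge.ofSMul M hM).restrictField L)) 1) ∧
      (∀ c : subgroupH1 (decompIn U w) M,
        Ψ c ∈ DiscreteGaloisModule.unramifiedSubgroup (GaloisRep.toLocal w' ((LocBridge.ofSMul M hM).restrictField L)) 1 ↔
          resOfLe M (inertiaIn_le_decompIn U w) c = 0) ∧
      (∀ c : subgroupH1 (decompIn U w) M₀,
        Ψ₀ c ∈ DiscreteGaloisModule.unramifiedSubgroup (GaloisRep.toLocal w' ((LocBridge.ofSMul M₀ hM₀).restrictField L)) 1 ↔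
          resOfLe M₀ (inertiaIn_le_decompIn U w) c = 0) ∧
      Function.Injective Ψ ∧ Function.Injective Ψ₀ ∧
      (∀ c : subgroupH1 (decompIn U w) M₀,
        localMap jL (Sum.inr w') (Ψ₀ c) =
          Ψ (resH1Hom (ContinuousMonoidHom.id (decompIn U w)) j (fun g m ↦ hj ((g : decomp w) : absoluteGaloisGroup K) m) c)) := by
  obtain ⟨θΨ₀, Ψ₀, hθ₀, hΨ₀, -, hβ2₀, hinj₀⟩ :=
    exists_localTransport L U hU M₀ hM₀ w (σ * absGaloisRestrict K L τ) w' (inf_conj_mul_eq_map_of_conj L U hD)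
      (inf_conj_mul_eq_map_of_conj L U hI)
  obtain ⟨θΨ, Ψ, hθ, hΨ, hβ1, hβ2, hinj⟩ :=
    exists_localTransport L U hU M hM w (σ * absGaloisRestrict K L τ) w' (inf_conj_mul_eq_map_of_conj L U hD)
      (inf_conj_mul_eq_map_of_conj L U hI)
  have hβ1' : ∀ z : subgroupH1 U M, Ψ (resH1Hom (decompInToH U w) (AddMonoidHom.id M) (fun _ _ ↦ rfl) (conjH1 U M σ z)) =
      galoisCohomology.localization ((LocBridge.ofSMul M hM).restrictField L) (Sum.inr w') 1 (Θ z) := fun z ↦ by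
    rw [← conjH1_mul_of_mem_eq U M (absGaloisRestrict_mem L U hU τ) z]
    exact hβ1 Θ hΘ z
  refine ⟨Ψ₀, Ψ, hβ1', fun z ↦ ?_, hβ2, hβ2₀, hinj, hinj₀, fun c ↦ ?_⟩
  · refine (mem_unramifiedKer_iff_resOfLe_resH1Hom_eq_zero U M w _).trans ?_
    rw [← hβ2, hβ1']
    exact Iff.rfl
  · -- (β3): the cocycle characterisations of `Ψ₀`, `Ψ` use `σ₁ = σ · res τ`; rewrite `σ₁⁻¹ • _` accordingly
    exact localMap_transport_comm L U M₀ hM₀ M hM j hj w (σ * absGaloisRestrict K L τ) w' jL hjL θΨ₀ θΨ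
      (fun g ↦ by rw [hθ₀, hθ]) Ψ₀ hΨ₀ Ψ hΨ c

end Package

/-! ## §4. The package on the double cosets `D_w \ Γ_K / U` (all places `w`, all `q`, representatives `q.out`) -/

section DoubleCoset

variable {K : Type} [Field K] [NumberField K] (L : IntermediateField K (AlgebraicClosure K)) [NumberField L] [Normal K L]
  (U : Subgroup (absoluteGaloisGroup K)) [U.Normal] (hUL : galFixing K L = U)
  (M₀ : Type) [AddCommGroup M₀] [DistribMulAction (absoluteGaloisGroup K) M₀] [TopologicalSpace M₀] [DiscreteTopology M₀]
  (hM₀ : ∀ m : M₀, IsOpen {σ : absoluteGaloisGroup K | σ • m = m})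
  (M : Type) [AddCommGroup M] [DistribMulAction (absoluteGaloisGroup K) M] [TopologicalSpace M] [DiscreteTopology M]
  (hM : ∀ m : M, IsOpen {σ : absoluteGaloisGroup K | σ • m = m})
  (j : M₀ →+ M) (hj : ∀ (σ : absoluteGaloisGroup K) (m : M₀), j (σ • m) = σ • j m)

include hUL in
/-- **THE H¹-TRANSPORT FOR THE LAYER FIELD, PACKAGED ON THE DOUBLE COSETS** (road (a) of the S3n′ fact-free road; -w7 g6's (R1)–(R3)). For
`L ⊆ K̄` normal finite over `K` and `U = Gal(K̄/L)` (`hUL : galFixing K L = U`; e.g. `U := κ₂.layerSubgroup n`, `L := κ₂.layer n`, tree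
`galFixing_layer`), a pair of discrete `Γ_K`-modules `j : M₀ → M`: there are `Θ : H¹(U, M) ≃ H¹(Γ_L, M|res)`, the intertwining map `jL` of `j`
over `L`, and bijections `f w : D_w \ Γ_K / U ≃ {w' ∣ w}` such that for every finite `w` and every double coset `q`, at `w' := f w q`, local
transports `Ψ₀`, `Ψ` exist with: (β1) `Ψ (res_{U⊓D_w}(conjH1 U M q.out z)) = loc_{w'} (Θ z)`; (α′) `conjH1 U M q.out z ∈ unramifiedKer U M w ↔
loc_{w'} (Θ z) ∈ H¹_ur(L_{w'})`; (β2) `Ψ c ∈ H¹_ur ↔ res_{U⊓I_w} c = 0` (both modules); (β2') injectivity; (β3) `localMap jL ∘ Ψ₀ = Ψ ∘ H¹(id, j)`.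
[cite: NeukirchANT1999, Ch. I §9 p. 54] [cite: SerreGaloisCohomology1997, I §2.4–§2.5, §5.1] [cite: GreenbergLNM1716, §2] -/
theorem exists_transport :
    ∃ (Θ : subgroupH1 U M ≃+ galoisCohomology ((LocBridge.ofSMul M hM).restrictField L) 1)
      (jL : ((LocBridge.ofSMul M₀ hM₀).restrictField L).toContRepresentation →ⁱL ((LocBridge.ofSMul M hM).restrictField L).toContRepresentation)
      (f : ∀ w : HeightOneSpectrum (𝓞 K), DoubleCoset.Quotient (decomp w : Set (absoluteGaloisGroup K)) U ≃ w.Extension (𝓞 L)),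
      (∀ m, jL m = j m) ∧
      ∀ (w : HeightOneSpectrum (𝓞 K)) (q : DoubleCoset.Quotient (decomp w : Set (absoluteGaloisGroup K)) U),
        ∃ (Ψ₀ : subgroupH1 (decompIn U w) M₀ →+ galoisCohomology (GaloisRep.toLocal (f w q).1 ((LocBridge.ofSMul M₀ hM₀).restrictField L)) 1)
          (Ψ : subgroupH1 (decompIn U w) M →+ galoisCohomology (GaloisRep.toLocal (f w q).1 ((LocBridge.ofSMul M hM).restrictField L)) 1),
          (∀ z : subgroupH1 U M,
            Ψ (resH1Hom (decompInToH U w) (AddMonoidHom.id M) (fun _ _ ↦ rfl) (conjH1 U M q.out z)) =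
              galoisCohomology.localization ((LocBridge.ofSMul M hM).restrictField L) (Sum.inr (f w q).1) 1 (Θ z)) ∧
          (∀ z : subgroupH1 U M,
            conjH1 U M q.out z ∈ GreenbergVatsal2000.unramifiedKer U M w ↔
              galoisCohomology.localization ((LocBridge.ofSMul M hM).restrictField L) (Sum.inr (f w q).1) 1 (Θ z) ∈
                DiscreteGaloisModule.unramifiedSubgroup (GaloisRep.toLocal (f w q).1 ((LocBridge.ofSMul M hM).restrictField L)) 1) ∧
          (∀ c : subgroupH1 (decompIn U w) M,
            Ψ c ∈ DiscreteGaloisModule.unramifiedSubgroup (GaloisRep.toLocal (f w q).1 ((LocBridge.ofSMul M hM).restrictField L)) 1 ↔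
              resOfLe M (inertiaIn_le_decompIn U w) c = 0) ∧
          (∀ c : subgroupH1 (decompIn U w) M₀,
            Ψ₀ c ∈ DiscreteGaloisModule.unramifiedSubgroup (GaloisRep.toLocal (f w q).1 ((LocBridge.ofSMul M₀ hM₀).restrictField L)) 1 ↔
              resOfLe M₀ (inertiaIn_le_decompIn U w) c = 0) ∧
          Function.Injective Ψ ∧ Function.Injective Ψ₀ ∧
          (∀ c : subgroupH1 (decompIn U w) M₀,
            localMap jL (Sum.inr (f w q).1) (Ψ₀ c) =
              Ψ (resH1Hom (ContinuousMonoidHom.id (decompIn U w)) j (fun g m ↦ hj ((g : decomp w) : absoluteGaloisGroup K) m) c)) := by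
  subst hUL
  have hU : (absGaloisRestrict K L).toMonoidHom.range = galFixing K L := range_absGaloisRestrict_eq_galFixing L
  obtain ⟨Θ, hΘ⟩ := exists_addEquiv_subgroupH1_galoisCohomology L (galFixing K L) hU M hM
  obtain ⟨jL, hjL⟩ := exists_contIntertwiningMap_restrictField L M₀ hM₀ M hM j hj
  choose f hf using fun w : HeightOneSpectrum (𝓞 K) ↦ exists_equiv_doubleCoset_extension L w
  refine ⟨Θ, jL, f, hjL, fun w q ↦ ?_⟩
  obtain ⟨τ, hD, hI⟩ := (hf w).2 q.out
  have hq : DoubleCoset.mk (decomp w) (galFixing K L) q.out = q := DoubleCoset.out_eq' _ _ q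
  simp only [hq] at hD hI
  exact exists_transport_of_conj L (galFixing K L) hU M₀ hM₀ M hM j hj w q.out (f w q).1 τ hD hI Θ hΘ jL hjL

end DoubleCoset

end Summit.BirchSwinnertonDyer.BirchSwinnertonDyer.Theorems.PrintCf2.LayerFieldH1
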